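import Summits.BirchSwinnertonDyer.BirchSwinnertonDyer.Theses.ClassRecordThree
import Summits.BirchSwinnertonDyer.Rank1Residual.X2.CellCBDPValueLZZRoadInputOfFact
import Literature.NumberTheory.EllipticCurves.UnrIntegersUnits
import Literature.NumberTheory.QuadraticFields.FundamentalDiscriminant
import HarnessLib

/-!
# Crux `ValueContinuityAtThree` (VC₃, stmt-BirchSwinnertonDyer-19493; route `ClassRecordThree`, cell `bsd-stepL`) —
# line `lzz`, SKELETON v1 (bsd-stepL plan g32 RULING 17 (C)(β); written by cell `bsd-eis`, seat `bsd-eis-cgshw` g15)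

HONEST FRAMING: a crux workfile (`Cruxes/ValueContinuityAtThree/Lines/lzz.lean`), NOT a proposal; nothing booked; O2 / B10 stay as
labelled; no node, label or count moves; BSD(E,3) is proved for no class. `ValueContinuityAtThree_of` concludes the crux BY NAME
from three registered stubs; sorries ONLY in `stub_*`.

IDEA (line lzz = Liu–Zhang–Zhang at `3 ∥ N`). The bsd-eis kernel rescale `X2.exists_continuousDisplay_of_lzzRoadInputIoo` (p512988;
cgshw MEMO-18 §5) of the REFEREED Liu–Zhang–Zhang fact (Duke 167 Thm 1.5.1 ∧ 1.5.3, typed p509230, glue p515022) gives VC₃'s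
display with a unit `u ∈ ℂ₃`, `‖u‖ = 1` — enough for (VN₃) / the leaf 19406 / `HalvesAtThree` (p522944) and for (VC₃′)
`ValueContinuityAtThreeNormOne` (p525241), but VC₃ VERBATIM types `u ∈ R₀ˣ`. On the FACT's own road (§1.5 of LZZ: witnesses
`ξ = 1`, `g = 1/4`, `sC = 1`) the rescale's unit is EXPLICIT: `u = s·ι'⁻¹(2)·ι'⁻¹(c_M)⁻²·ι'⁻¹(√|d_K|)⁻¹`, `s = ±1` — and that IS
a unit of `R₀ = unrIntegers 3`: `2, c_M ∈ ℤ` with `3 ∤ 2c_M`, and `√|d_K| ∈ R₀` because `|d_K|` is squarefree and prime to `3`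
(quadratic Gauss sums: `√q* ∈ ℤ[ζ_q] ⊂ R₀` for every odd prime `q ≠ p`, `√−1 = ζ₄`). STUBS (3):
`stub_lzzFact` [PUB by name: the refereed fact] · `stub_sqrt_mem_unrIntegers` [M: `√m ∈ R₀` for squarefree `m` with `p ∤ 2m`;
Gauss sums `gaussSum_sq` in Mathlib] · `stub_unitExport` [L: the FACT-level display with the unit IDENTIFIED as above —
provable by re-running p512988's proof with the glue's witnesses instead of the opaque `∃ ξ`; ≈ 400 l.]. COMPOSITION: the
identified unit lies in `R₀` (`intCast_mem_unrIntegers`, `unrIntegers.inv_mem_of_norm_eq_one`, the square root from [M] up to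
sign) and has norm `1` (`PNewDisplay.norm_map_natCast_eq_one`, `norm_map_sqrt_discr_eq_one`), hence is a unit of `R₀`
(`unrIntegers.isUnit_iff_norm_eq_one`); `|d_K|` is squarefree and `3 ∤ d_K` by `Quadratic.isFundamentalDiscriminant_discr` (odd
`d_K`) and `SatisfiesHeegnerHypothesis.not_dvd_discr` (`3 ∣ N` splits).

References: [LiuZhangZhang2018] Duke Math. J. 167 (2018) Thm 1.5.1, Rem 1.1.2, Thm 1.5.3 (pp. 745–749); [Castella2018] Thm 3.1–3.2
(shape); Mathlib `gaussSum_sq`; pub/bsd-eis/cgshw-MEMO-18 §5, MEMO-19 §8; pub/bsd-stepL PROOF-BDP §20, RULING 17 (C).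
-/

set_option autoImplicit false
set_option linter.dupNamespace false

noncomputable section

open scoped Classical Topology

open Filter WeierstrassCurve NumberField IsDedekindDomain Field PowerSeries
  Literature.NumberTheory.EllipticCurves Literature.NumberTheory.EllipticCurves.ModularForms
  Literature.NumberTheory.EllipticCurves.Rank1Residual
  Literature.NumberTheory.GaloisRepresentations Literature.NumberTheory.GaloisCohomology
  Summit.BirchSwinnertonDyer.Rank1Residual Summit.BirchSwinnertonDyer.Rank1Residual.X11b
  Summit.BirchSwinnertonDyer.Rank1Residual.X11b.Halves
  Summit.BirchSwinnertonDyer.Rank1Residual.X11b.Three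

namespace Summit.BirchSwinnertonDyer.BirchSwinnertonDyer.Cruxes.ValueContinuityAtThree.Lzz

/-- **stub_lzzFact** [fact-grade, PUBLISHED and REFEREED, typed p509230 — closed BY NAME the day the crux may take a Literature
fact as input; not provable in the kernel]: Liu–Zhang–Zhang, Duke Math. J. 167 (2018) Thm 1.5.1 (with Remark 1.1.2) ∧ Thm 1.5.3 for
`X₀(N) → E`, the Heegner test vector and `χ = 𝟙` at a prime `p ∣ N`, `p² ∤ N` split in `K`.
[cite: LiuZhangZhang2018, Thm. 1.5.1 and Remark 1.1.2 and Thm. 1.5.3 (Duke Math. J. 167 (2018) pp. 745–749)] -/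
theorem stub_lzzFact : LiuZhangZhang2018.thm151_thm153_modularCurve_heegnerVector := by
  sorry

/-- **stub_sqrt_mem_unrIntegers** [M, kernel-provable]: a squarefree natural number `m` prime to `2p` has a square root in
`R₀ = unrIntegers p` (the completed ring of integers of `ℚ_p^ur` inside `ℂ_p`). Printed road: for each odd prime `q ∣ m` the
quadratic Gauss sum `g_q ∈ ℤ[ζ_q]` has `g_q² = (−1)^{(q−1)/2} q` (Mathlib `gaussSum_sq`), `√−1 = ζ₄`, and `ζ_q, ζ₄ ∈ R₀` as roots
of unity of order prime to `p` (`mem_unrIntegers_of_pow_eq_one`). [cite: IrelandRosen1990, Prop. 6.3.2 (the sign of the quadratic Gauss sum squared)] -/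
theorem stub_sqrt_mem_unrIntegers :
    ∀ (p : ℕ) [Fact p.Prime] (m : ℕ), Squarefree m → ¬ p ∣ 2 * m →
      ∃ x : ℂ_[p], x ∈ unrIntegers p ∧ x ^ 2 = (m : ℂ_[p]) := by
  sorry

/-- **stub_unitExport** [L, kernel-provable: the FACT-level continuity display with the unit IDENTIFIED]: at every X11b@3
classical datum of VC₃, from the refereed LZZ fact, Castella's display tends to
`s·ι'⁻¹(2)·ι'⁻¹(c_M)⁻²·ι'⁻¹(√|d_K|)⁻¹·((1 − a₃·3⁻¹)·log_{ω_E} P)²` with `s = ±1` — the unit of the bsd-eis rescale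
(`X2.exists_continuousDisplay_of_lzzRoadInputIoo`, p512988: `u = s₂·ι⁻¹(32g/(sC·c_M²·w_K²·√δ_K))·ι⁻¹(ξ)⁻¹`) evaluated at the
glue's witnesses `ξ = 1`, `g = 1/4`, `sC = 1`, `w_K = 2` (p515022). To prove it, re-run p512988's proof from the FACT instead of
the typed input (the opaque `∃ ξ` is what loses the shape). [cite: LiuZhangZhang2018, Thm. 1.5.1 and Thm. 1.5.3 (Duke 167 pp. 748–749)] -/
theorem stub_unitExport :
    LiuZhangZhang2018.thm151_thm153_modularCurve_heegnerVector →
    ∀ (W : WeierstrassCurve ℚ) [W.IsElliptic] [W.IsGloballyMinimal],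
    ∀ (N : ℕ) [NeZero N] (K : Type) [Field K] [NumberField K] (Dt : ModularParametrizationData W N)
      (H : HeegnerDatum N (NumberField.discr K)) (ι : K →+* ℂ) (P : (W.baseChange K).toAffine.Point),
      ClassX11b W 3 → Surj W 3 → W.conductorNorm ℤ = N → IsImaginaryQuadratic K →
      Odd (NumberField.discr K) → SatisfiesHeegnerHypothesis N K →
      (W.quadraticTwist (NumberField.discr K : ℚ)).entireLFunction 1 ≠ 0 →
      WeierstrassCurve.Affine.Point.map ι.toRatAlgHom P = heegnerPointComplex Dt H →
      ¬ (3 : ℤ) ∣ Dt.c → ¬ IsOfFinAddOrder P →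
      ∀ (κ : ZpExtension K 3), κ.IsAnticyclotomic →
        ∀ (γ : Field.absoluteGaloisGroup K) [Fact (κ.IsTopGenerator γ)]
          (𝔭 : HeightOneSpectrum (𝓞 K)) (h𝔭 : ((3 : ℕ) : 𝓞 K) ∈ 𝔭.asIdeal)
          (he : 𝔭.asIdeal.ramificationIdx (𝓞 ℚ) = 1) (hf : 𝔭.asIdeal.inertiaDeg (𝓞 ℚ) = 1),
          ∀ (f : CuspForm (CongruenceSubgroup.Gamma0 N) 2), IsNewformOf W f →
            ∀ (ι' : PadicAlgCl 3 ≃+* ℂ), InducesPrime ι' 𝔭 →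
              ∃ (ΩK : ℂ) (Ωp : ℂ_[3]) (s : ℤ), ΩK ≠ 0 ∧ Ωp ≠ 0 ∧ (s = 1 ∨ s = -1) ∧
                ∀ (φ : ℕ → HeckeCharacter K) (n : ℕ → ℕ) (r : ℕ → FramedGaloisRep K (PadicAlgCl 3) 1),
                  (∀ k, 0 < n k) → (∀ k (v : HeightOneSpectrum (𝓞 K)), (φ k).IsUnramifiedAt v) →
                  (∀ k, (φ k).HasInfinityType (fun _ ↦ (n k : ℤ)) (fun _ ↦ -(n k : ℤ))) →
                  (∀ k, IsPAdicAvatarOf ι' (φ k) (r k)) → (∀ k, FactorsThroughZp κ (r k)) →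
                  Tendsto (fun k ↦ avatarValueAt (r k) γ) atTop (𝓝 1) →
                  Tendsto (fun k ↦ ((ι'.symm (bdpInterpolationValue 3 f 𝔭 (φ k) (n k) ΩK) :
                    PadicAlgCl 3) : ℂ_[3]) * Ωp ^ (4 * n k)) atTop
                    (𝓝 ((s : ℂ_[3]) * ((ι'.symm (2 : ℂ) : PadicAlgCl 3) : ℂ_[3]) *
                      ((((ι'.symm ((Dt.c : ℤ) : ℂ) : PadicAlgCl 3) : ℂ_[3])) ^ 2)⁻¹ *
                      (((ι'.symm ((Real.sqrt |(NumberField.discr K : ℝ)| : ℝ) : ℂ) : PadicAlgCl 3) : ℂ_[3]))⁻¹ *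
                      (algebraMap ℚ_[3] ℂ_[3] (((1 : ℚ_[3]) - ((W.LFunction 3 : ℤ) : ℚ_[3]) *
                        (3 : ℚ_[3])⁻¹) * logOmega W 3 (embAt K 3 𝔭 h𝔭 he hf) P)) ^ 2)) := by
  sorry

/-- **COMPOSITION — `ValueContinuityAtThree_of`: the three stubs imply the crux BY NAME.** The identified unit
`u = s·ι'⁻¹(2)·ι'⁻¹(c_M)⁻²·ι'⁻¹(√|d_K|)⁻¹` lies in `R₀` (integers; inverse of a norm-one element of `R₀`; `ι'⁻¹(√|d_K|) = ±x` for the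
square root `x ∈ R₀` of [M] — `|d_K|` squarefree and prime to `3`) and has norm `1`, hence is a unit of `R₀`
(`unrIntegers.isUnit_iff_norm_eq_one`); with that unit the display of [L] is VC₃'s display verbatim. No sorry outside the stubs.
[cite: LiuZhangZhang2018, Thm. 1.5.1 and Thm. 1.5.3 (Duke 167 pp. 748–749)] -/
theorem ValueContinuityAtThree_of :
    Summit.BirchSwinnertonDyer.BirchSwinnertonDyer.Theses.ClassRecordThree.ValueContinuityAtThree := by
  unfold Summit.BirchSwinnertonDyer.BirchSwinnertonDyer.Theses.ClassRecordThree.ValueContinuityAtThree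
  intro W _ _ N _ K _ _ Dt H ι P hX hsurj hN hK hodd hHN hLt hP hcM hPinf κ hκ γ hγ 𝔭 h𝔭 he hf f hfW ι' hι'
  have hp : (3 : ℕ).Prime := Fact.out
  obtain ⟨ΩK, Ωp, s, hΩK, hΩp, hs, hcont⟩ := stub_unitExport stub_lzzFact W N K Dt H ι P hX hsurj hN hK hodd hHN hLt hP
    hcM hPinf κ hκ γ 𝔭 h𝔭 he hf f hfW ι' hι'
  -- the embedding `ι'⁻¹ : ℂ → ℂ₃` as a ring map
  set em : ℂ →+* ℂ_[3] := (algebraMap (PadicAlgCl 3) ℂ_[3]).comp ι'.symm.toRingHom with hem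
  have hem' : ∀ z : ℂ, ((ι'.symm z : PadicAlgCl 3) : ℂ_[3]) = em z := fun z ↦ rfl
  -- `3 ∣ N`, `3 ∤ d_K`, `|d_K|` squarefree
  have hmult : W.HasMultiplicativeReductionAtPrime 3 := hX.2.2.1
  have hpN : 3 ∣ N := hN ▸ X11b.dvd_conductorNorm_of_mult (W := W) hmult
  have hdisc : ¬ ((3 : ℕ) : ℤ) ∣ NumberField.discr K :=
    Literature.SatisfiesHeegnerHypothesis.not_dvd_discr hK.1 hHN hp hpN
  have hsqf : Squarefree (NumberField.discr K).natAbs := by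
    rcases Literature.NumberTheory.QuadraticFields.Quadratic.isFundamentalDiscriminant_discr (K := K) hK.1 with
      ⟨-, hsq, -⟩ | ⟨h4, -, -⟩
    · exact Int.squarefree_natAbs.mpr hsq
    · exfalso
      obtain ⟨m, hm⟩ := hodd
      obtain ⟨c, hc⟩ := h4
      omega
  have hcop : ¬ 3 ∣ 2 * (NumberField.discr K).natAbs := by
    intro h
    rcases (Nat.Prime.dvd_mul hp).mp h with h2 | h2
    · omega
    · exact hdisc (Int.natCast_dvd.mpr h2)
  -- the square root of `|d_K|` in `R₀`
  obtain ⟨x, hxR, hx2⟩ := stub_sqrt_mem_unrIntegers 3 (NumberField.discr K).natAbs hsqf hcop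
  set δ : ℂ_[3] := em ((Real.sqrt |(NumberField.discr K : ℝ)| : ℝ) : ℂ) with hδ
  have hδ2 : δ ^ 2 = ((NumberField.discr K).natAbs : ℂ_[3]) := by
    have hcast : ((|(NumberField.discr K : ℝ)| : ℝ) : ℂ) = (((NumberField.discr K).natAbs : ℕ) : ℂ) := by
      rw [Nat.cast_natAbs, ← Complex.ofReal_intCast, Int.cast_abs]
    rw [hδ, ← map_pow, ← Complex.ofReal_pow, Real.sq_sqrt (abs_nonneg _), hcast, map_natCast]
  have hδR : δ ∈ unrIntegers 3 := by
    have h := hδ2.trans hx2.symm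
    rcases sq_eq_sq_iff_eq_or_eq_neg.mp h with h' | h'
    · rw [h']; exact hxR
    · rw [h']; exact neg_mem hxR
  have hδ1 : ‖δ‖ = 1 := by
    rw [hδ]; exact X2.PNewDisplay.norm_map_sqrt_discr_eq_one em hdisc
  -- the Manin constant and `2` are units of `R₀`
  have hc1 : ‖em ((Dt.c : ℤ) : ℂ)‖ = 1 := X2.norm_map_intCast_eq_one em hcM
  have hcR : em ((Dt.c : ℤ) : ℂ) ∈ unrIntegers 3 := by
    rw [map_intCast]; exact intCast_mem_unrIntegers _
  have h2R : em (2 : ℂ) ∈ unrIntegers 3 := by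
    rw [map_ofNat]; exact_mod_cast intCast_mem_unrIntegers (p := 3) 2
  have h21 : ‖em (2 : ℂ)‖ = 1 := by
    rw [show (2 : ℂ) = ((2 : ℕ) : ℂ) by norm_num]
    exact X2.PNewDisplay.norm_map_natCast_eq_one em (by decide)
  have hsR : ((s : ℂ_[3])) ∈ unrIntegers 3 := intCast_mem_unrIntegers s
  have hs1 : ‖(s : ℂ_[3])‖ = 1 := by rcases hs with h | h <;> simp [h]
  -- the identified unit
  set u : ℂ_[3] := (s : ℂ_[3]) * em (2 : ℂ) * ((em ((Dt.c : ℤ) : ℂ)) ^ 2)⁻¹ * δ⁻¹ with hu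
  have huR : u ∈ unrIntegers 3 := by
    refine mul_mem (mul_mem (mul_mem hsR h2R) ?_) (unrIntegers.inv_mem_of_norm_eq_one hδR hδ1)
    exact unrIntegers.inv_mem_of_norm_eq_one (pow_mem hcR 2) (by rw [norm_pow, hc1, one_pow])
  have hu1 : ‖u‖ = 1 := by
    rw [hu, norm_mul, norm_mul, norm_mul, norm_inv, norm_inv, norm_pow, hs1, h21, hc1, hδ1]; norm_num
  have hunit : IsUnit (⟨u, huR⟩ : unrIntegers 3) := (unrIntegers.isUnit_iff_norm_eq_one _).mpr hu1
  refine ⟨ΩK, Ωp, hunit.unit, hΩK, hΩp, fun φ n r hn hunr hinf hav hfac hlim ↦ ?_⟩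
  have hcoe : ((hunit.unit : unrIntegers 3) : ℂ_[3]) = u := by
    rw [IsUnit.unit_spec]
  rw [hcoe, hu, hδ, ← hem', ← hem', ← hem']
  exact hcont φ n r hn hunr hinf hav hfac hlim

end Summit.BirchSwinnertonDyer.BirchSwinnertonDyer.Cruxes.ValueContinuityAtThree.Lzz

end
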